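import Literature.NumberTheory.EllipticCurves.EisensteinNewformLevelRaisingDeligneSerreLiftProofs
import Literature.NumberTheory.EllipticCurves.EigenvectorLevelPrimeNewformDichotomy
import Literature.NumberTheory.EllipticCurves.HeckeEigenvectorModPOfCongruence
import Literature.NumberTheory.EllipticCurves.EisensteinSeriesNebentypusLevelRaised
import Literature.NumberTheory.ModularForms.TwistedDivisorSumsHecke
import HarnessLib

/-!
# From a cusp form congruent to the level-raised Eisenstein series to a newform
# (Billerey–Menares, proof of Thm. 2.2 — the steps after the lift; proofs only)

Topic `Literature/NumberTheory/EllipticCurves`; namespace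
`Literature.NumberTheory.EllipticCurves.ModularForms`.  THEOREMS ONLY (no definition, no named
fact; D-0026).  A proofs-only companion of the named facts
`Literature.NumberTheory.EllipticCurves.BillereyMenares2016_thm22_exists_newform(_odd)` and
`Literature.NumberTheory.EllipticCurves.BillereyMenares2018_exists_newform`
(`EisensteinNewformLevelRaising.lean`).

## The statement (`exists_isNewform1_of_congruent_eisensteinLevelRaised`)

Let `p` be a prime, `ι : ℚ̄_p ≃ ℂ`, `χ` a primitive Dirichlet character modulo `N`, `p ∤ N`, of
parity `χ(-1) = (-1)^k` (`k ≥ 3`) and of order prime to `p` (`χ^m = 1`, `p ∤ m`), `M ∤ Np` an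
auxiliary prime, and let `F₂ = E_k^{𝟙,χ} - M^{1-k}·E_k^{𝟙,χ}|diag(M,1) ∈ M_k(Γ₁(NM))`
(`eisensteinLevelRaised`) be the level-raised Eisenstein series.  SUPPOSE a cusp form
`G ∈ S_k(NM, χ)` with `p`-integral Fourier coefficients congruent to those of `F₂` modulo the
maximal ideal `𝔪` of `𝒪_{ℚ̄_p}` (read through `ι`) is given — this is the output of the
Deligne–Rapoport / Katz–Carayol lifting step of the printed proofs, NOT proved here.  THEN there is
a newform `g` of weight `k` and level `N' ∈ {N, NM}`, `p ∤ N'`, whose nebentypus has conductor `N`,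
order dividing `m`, and values `χ(ℓ)` at the primes `ℓ ∤ N'`, with
`a_ℓ(g) ≡ 1 + χ(ℓ) ℓ^{k-1} (mod 𝔪)` for every prime `ℓ ∤ N'` and `a_p(g) ≡ 1 (mod 𝔪)`.

## The proof (Billerey–Menares 2016, proof of Thm. 2.2, p. 7; 2018, §3.2)

* `(A)` the coefficients `b_n = σ^χ_{k-1}(n) - [M ∣ n] σ^χ_{k-1}(n/M)` of `F₂` satisfy the Hecke
  relations `b_{qn} + χ(q)q^{k-1}[q ∣ n] b_{n/q} = (1 + χ(q)q^{k-1}) b_n` (`q ∤ NM`, tree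
  `levelRaised_hecke`) and `b_{Mn} = χ(M)M^{k-1} b_n` (`levelRaised_U`, multiplicativity of `σ^χ`);
* `(B)` hence `G` is an eigenvector MODULO `𝔪` of the `T_q`, `q ∤ NM`
  (`valuation_cuspCoeff_heckeT_sub_lt_one`) and of `U_M` (`a_n(U_M G) = a_{Mn}(G)`), with unit
  `U_M`-eigenvalue `χ(M)M^{k-1}`, and `a_1(G) ≡ 1` is a unit;
* `(C)` Deligne–Serre lifting inside `S_k(NM, χ)` read through `ι`
  (`DeligneSerreLift.exists_eigenform_of_congruence`, built on the tree's lemma over the valuation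
  ring of the algebraically closed field `ℚ̄_p`) gives a genuine common eigenvector `g₁ ∈ S_k(NM, χ)`
  of the `T_q` (`q ∤ NM`) and of `U_M`, with congruent eigenvalues — in particular a NON-ZERO
  `U_M`-eigenvalue `u ≡ χ(M)M^{k-1}`;
* `(D)` the newform attached to `g₁` (`exists_isNewform1_or_of_eigenvector_mul_prime`,
  Atkin–Lehner–Li without strong multiplicity one): either a newform of level `NM` with the same
  `T_q`-eigenvalues and nebentypus `χ`, or a newform `g₀` of level `N` with the same
  `T_q`-eigenvalues, nebentypus `χ` and `a_M(g₀) = u + χ(M)M^{k-1}/u ≡ χ(M)M^{k-1} + 1`;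
* `(E)` bookkeeping of the congruences (`a_p ≡ 1 + χ(p)p^{k-1} ≡ 1` as `k ≥ 2`).

## References

* N. Billerey, R. Menares, *On the modularity of reducible mod `l` Galois representations*, Math.
  Res. Lett. 23 (2016), 15–41, §2, proof of Thm. 2.2 (p. 7). [BillereyMenares2016]
* N. Billerey, R. Menares, *Strong modularity of reducible Galois representations*, Trans. AMS
  370 (2018), 967–986, §3.2. [BillereyMenares2018]
* F. Diamond, J. Shurman, *A First Course in Modular Forms*, GTM 228, Springer 2005, Prop. 5.2.2–5.2.3,
  §5.6–5.8. [DiamondShurman2005]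
* P. Deligne, J.-P. Serre, *Formes modulaires de poids 1*, Ann. Sci. ÉNS (4) 7 (1974), Lemme 6.11.
  [DeligneSerreASENS1974]
-/

noncomputable section

open scoped MatrixGroups ModularForm
open CongruenceSubgroup UpperHalfPlane

/-! ### `(A)` The `U_M`-relation for the coefficients of `F₂` -/

namespace Literature.NumberTheory.ModularForms

open ArithmeticFunction Nat Finset

variable {R : Type*} [CommRing R] {N : ℕ} (χ : DirichletCharacter R N) (j : ℕ)

/-- **The `U_M`-relation survives level raising**: for a prime `M` and `n ≥ 1` the coefficients
`b_n = a_n - [M ∣ n] a_{n/M}` of `F₂ = E - E(M·)` (`a_n = σ_j^χ(n)`) satisfy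
`b_{Mn} = χ(M) M^j b_n`, i.e. `σ_j^χ(Mn) - σ_j^χ(n) = χ(M)M^j (σ_j^χ(n) - [M ∣ n] σ_j^χ(n/M))`
(multiplicativity and `σ_j^χ(M^{a+1}) - σ_j^χ(M^a) = (χ(M)M^j)^{a+1}`).
[cite: BillereyMenares2018, §3.2 (`U_M F₂ = χ(M)M^{k-1} F₂`); DiamondShurman2005, Prop. 5.2.3] -/
theorem levelRaised_U {M : ℕ} (hM : M.Prime) {n : ℕ} (hn : n ≠ 0) :
    (∑ d ∈ (M * n).divisors, χ d * (d : R) ^ j) - (∑ d ∈ n.divisors, χ d * (d : R) ^ j) =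
      χ M * (M : R) ^ j *
        ((∑ d ∈ n.divisors, χ d * (d : R) ^ j) -
          (if M ∣ n then ∑ d ∈ (n / M).divisors, χ d * (d : R) ^ j else 0)) := by
  obtain ⟨a, m, hm, rfl⟩ := Nat.exists_eq_pow_mul_and_not_dvd hn M hM.ne_one
  have hcop : ∀ b, (M ^ b).Coprime m := fun b ↦
    Nat.Coprime.pow_left b ((Nat.Prime.coprime_iff_not_dvd hM).2 hm)
  have h1 : M * (M ^ a * m) = M ^ (a + 1) * m := by ring
  rw [h1, twistedSigma_mul_of_coprime χ j (hcop _), twistedSigma_mul_of_coprime χ j (hcop _),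
    twistedSigma_prime_pow χ j hM, twistedSigma_prime_pow χ j hM,
    Finset.sum_range_succ _ (a + 1)]
  rcases Nat.eq_zero_or_pos a with rfl | ha
  · have hMn : ¬ M ∣ M ^ 0 * m := by simpa using hm
    rw [if_neg hMn]
    simp
    ring
  · obtain ⟨a', rfl⟩ := Nat.exists_eq_add_of_le' ha
    have hMn : M ∣ M ^ (a' + 1) * m := ⟨M ^ a' * m, by ring⟩
    have hdiv : M ^ (a' + 1) * m / M = M ^ a' * m := by
      rw [show M ^ (a' + 1) * m = M * (M ^ a' * m) by ring, Nat.mul_div_cancel_left _ hM.pos]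
    rw [if_pos hMn, hdiv, twistedSigma_mul_of_coprime χ j (hcop _), twistedSigma_prime_pow χ j hM,
      Finset.sum_range_succ _ (a' + 1)]
    ring

end Literature.NumberTheory.ModularForms

namespace Literature.NumberTheory.EllipticCurves.ModularForms

open Literature.NumberTheory.ModularForms

/-! ### Norm bookkeeping in `ℚ̄_p` -/

section Norm

variable {p : ℕ} [Fact p.Prime]

/-- `Valued.v x < 1 ↔ ‖x‖ < 1` in `ℚ̄_p`. [folklore] -/
private theorem v_lt_one_iff (x : PadicAlgCl p) : Valued.v x < 1 ↔ ‖x‖ < 1 := by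
  rw [PadicAlgCl.valuation_def, ← NNReal.coe_lt_coe, coe_nnnorm, NNReal.coe_one]

/-- `Valued.v x ≤ 1 ↔ ‖x‖ ≤ 1` in `ℚ̄_p`. [folklore] -/
private theorem v_le_one_iff (x : PadicAlgCl p) : Valued.v x ≤ 1 ↔ ‖x‖ ≤ 1 := by
  rw [PadicAlgCl.valuation_def, ← NNReal.coe_le_coe, coe_nnnorm, NNReal.coe_one]

/-- Ultrametric inequality for differences. [folklore] -/
private theorem norm_sub_le_max'' (x y : PadicAlgCl p) : ‖x - y‖ ≤ max ‖x‖ ‖y‖ := by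
  have h := PadicAlgCl.isNonarchimedean p x (-y)
  rwa [norm_neg, ← sub_eq_add_neg] at h

/-- Chaining two congruences modulo `𝔪`. [folklore] -/
private theorem norm_sub_lt_one_trans' {x y z : PadicAlgCl p} (h₁ : ‖x - y‖ < 1)
    (h₂ : ‖y - z‖ < 1) : ‖x - z‖ < 1 := by
  have : x - z = (x - y) + (y - z) := by ring
  rw [this]
  exact (PadicAlgCl.isNonarchimedean p _ _).trans_lt (max_lt h₁ h₂)

/-- An element congruent to an element of norm `1` has norm `1`. [folklore] -/
private theorem norm_eq_one_of_norm_sub_lt_one {x y : PadicAlgCl p} (hy : ‖y‖ = 1)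
    (h : ‖x - y‖ < 1) : ‖x‖ = 1 := by
  apply le_antisymm
  · have h1 : x = (x - y) + y := by ring
    rw [h1]
    exact (PadicAlgCl.isNonarchimedean p _ _).trans (max_le h.le hy.le)
  · by_contra hlt
    push Not at hlt
    have h1 : y = x - (x - y) := by ring
    have h2 : ‖y‖ < 1 := by
      rw [h1]
      exact (norm_sub_le_max'' _ _).trans_lt (max_lt hlt h)
    rw [hy] at h2
    exact lt_irrefl _ h2

/-- Natural numbers have norm `≤ 1` in `ℚ̄_p`. [folklore] -/
private theorem norm_natCast_le_one' (n : ℕ) : ‖(n : PadicAlgCl p)‖ ≤ 1 := by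
  have h := DeligneSerreLift.norm_intCast_le_one (p := p) (n : ℤ)
  rwa [Int.cast_natCast] at h

/-- `‖p‖ < 1` in `ℚ̄_p`. [folklore] -/
private theorem norm_natCast_prime_lt_one' : ‖(p : PadicAlgCl p)‖ < 1 := by
  rw [← map_natCast (algebraMap ℚ_[p] (PadicAlgCl p)) p]
  change ‖((p : ℚ_[p]) : PadicAlgCl p)‖ < 1
  rw [PadicAlgCl.norm_extends]
  exact Padic.norm_p_lt_one

end Norm

/-! ### `(B)`–`(E)` The main theorem -/

section Main

variable {p : ℕ} [Fact p.Prime]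

set_option maxHeartbeats 1600000 in
/-- **From a cusp form congruent to the level-raised Eisenstein series to a newform**
(Billerey–Menares 2016, proof of Thm. 2.2, the steps after the lift; see the module docstring).
Hypotheses: `ι : ℚ̄_p ≃ ℂ`; `k ≥ 3`; `χ` primitive modulo `N`, `χ(-1) = (-1)^k`, `p ∤ N`,
`χ^m = 1` with `p ∤ m`; `M` a prime, `M ≠ p`, `M ∤ N`; `G ∈ S_k(NM, χ)` with
`‖ι⁻¹ a_n(G)‖ ≤ 1` and `‖ι⁻¹(a_n(G) - a_n(F₂))‖ < 1` for all `n`,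
`F₂ = eisensteinLevelRaised N k χ M`.  Conclusion: a newform `g` of weight `k` and level
`N' ∈ {N, NM}`, `p ∤ N'`, whose nebentypus has conductor `N`, `m`-th power `1` and values `χ(ℓ)`
at the primes `ℓ ∤ N'`, with `‖ι⁻¹ a_ℓ(g) - (1 + ι⁻¹(χ(ℓ)ℓ^{k-1}))‖ < 1` for every prime `ℓ ∤ N'`
and `‖ι⁻¹ a_p(g) - 1‖ < 1`.
[cite: BillereyMenares2016, §2, proof of Thm. 2.2 (p. 7)] [cite: BillereyMenares2018, §3.2] -/
theorem exists_isNewform1_of_congruent_eisensteinLevelRaised (ι : PadicAlgCl p ≃+* ℂ)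
    {N : ℕ} [NeZero N] {k : ℕ} (hk : 3 ≤ k) {χ : DirichletCharacter ℂ N} (hχ : χ.IsPrimitive)
    (hpar : χ (-1) = (-1) ^ k) (hpN : ¬ p ∣ N) {m : ℕ} (hm : ¬ p ∣ m) (hχm : χ ^ m = 1)
    {M : ℕ} [NeZero M] (hM : M.Prime) (hMp : M ≠ p) (hMN : ¬ M ∣ N)
    {G : CuspForm (Gamma1 (N * M)) k}
    (hGχ : G ∈ nebentypusSubspace (N * M) k
      (DirichletCharacter.changeLevel (dvd_mul_right N M) χ))
    (hGint : ∀ n, ‖ι.symm (cuspCoeff G n)‖ ≤ 1)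
    (hGF : ∀ n, ‖ι.symm (cuspCoeff G n -
      (qExpansion 1 ⇑(eisensteinLevelRaised N k χ M hk)).coeff n)‖ < 1) :
    ∃ (N' : ℕ) (_ : NeZero N') (g : CuspForm (Gamma1 N') k),
      IsNewform1 g ∧ ¬ p ∣ N' ∧ (N' = N ∨ N' = N * M) ∧ (nebentypus g).conductor = N ∧
      nebentypus g ^ m = 1 ∧
      (∀ ℓ : ℕ, ℓ.Prime → ¬ ℓ ∣ N' →
        ‖ι.symm (cuspCoeff g ℓ) - (1 + ι.symm (χ ℓ * (ℓ : ℂ) ^ (k - 1)))‖ < 1 ∧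
        nebentypus g (ℓ : ZMod N') = χ (ℓ : ZMod N)) ∧
      ‖ι.symm (cuspCoeff g p) - 1‖ < 1 := by
  classical
  have hp := (Fact.out : p.Prime)
  have hk1 : (1 : ℤ) ≤ (k : ℤ) := by exact_mod_cast (show 1 ≤ k by omega)
  have hm0 : m ≠ 0 := fun h0 ↦ hm (h0 ▸ dvd_zero p)
  have hpM : ¬ p ∣ M := fun h ↦ hMp ((Nat.prime_dvd_prime_iff_eq hp hM).1 h).symm
  have hpL : ¬ p ∣ N * M := fun h ↦ (hp.dvd_mul.1 h).elim hpN hpM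
  have hML : M ∣ N * M := dvd_mul_left M N
  have h1L := HeckeTGamma1.one_mem_strictPeriods_Gamma1 (N * M)
  set χ' : DirichletCharacter ℂ (N * M) := DirichletCharacter.changeLevel (dvd_mul_right N M) χ
    with hχ'
  set F := eisensteinLevelRaised N k χ M hk with hF
  -- ### `(A)` the coefficients of `F₂`
  set b : ℕ → ℂ := fun n ↦ (qExpansion 1 ⇑F).coeff n with hb
  set α : ℂ := χ M * (M : ℂ) ^ (k - 1) with hα
  set lam : ℕ → ℂ := fun q ↦ 1 + χ q * (q : ℂ) ^ (k - 1) with hlam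
  have hbn : ∀ n, b n = if n = 0 then 0 else
      (∑ d ∈ n.divisors, χ d * (d : ℂ) ^ (k - 1)) -
        (if M ∣ n then ∑ d ∈ (n / M).divisors, χ d * (d : ℂ) ^ (k - 1) else 0) :=
    fun n ↦ qExpansion_coeff_eisensteinLevelRaised k χ M hk hχ hpar n
  have hb0 : b 0 = 0 := by rw [hbn, if_pos rfl]
  have hb1 : b 1 = 1 := by
    rw [hbn, if_neg one_ne_zero, if_neg hM.not_dvd_one]
    simp
  have hbU : ∀ n, b (M * n) = α * b n := by
    intro n
    rcases Nat.eq_zero_or_pos n with rfl | hn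
    · rw [mul_zero, hb0, mul_zero]
    rw [hbn, if_neg (mul_ne_zero hM.ne_zero hn.ne'), if_pos ⟨n, rfl⟩,
      Nat.mul_div_cancel_left _ hM.pos, hbn n, if_neg hn.ne', hα]
    exact levelRaised_U χ (k - 1) hM hn.ne'
  have hbT : ∀ q : ℕ, q.Prime → ¬ q ∣ N * M → ∀ n, n ≠ 0 →
      b (q * n) + χ q * (q : ℂ) ^ (k - 1) * (if q ∣ n then b (n / q) else 0) = lam q * b n := by
    intro q hq hqL n hn
    have hqM : ¬ q ∣ M := fun h ↦ hqL (dvd_mul_of_dvd_right h N)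
    have h := levelRaised_hecke χ (k - 1) hq hqM (NeZero.ne M) hn
    rw [hbn (q * n), if_neg (mul_ne_zero hq.ne_zero hn), hbn n, if_neg hn, hlam]
    by_cases hqn : q ∣ n
    · have hnq : n / q ≠ 0 := by
        obtain ⟨c, rfl⟩ := hqn
        rw [Nat.mul_div_cancel_left _ hq.pos]
        rintro rfl; exact hn (mul_zero q)
      rw [if_pos hqn, hbn (n / q), if_neg hnq]
      rw [if_pos hqn] at h
      exact h
    · rw [if_neg hqn]
      rw [if_neg hqn] at h
      exact h
  -- ### norms of the constants
  have hnχ : ∀ a : ZMod N, ‖ι.symm (χ a)‖ ≤ 1 ∧ (IsUnit a → ‖ι.symm (χ a)‖ = 1) := by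
    intro a
    by_cases ha : IsUnit a
    · have h1 : ι.symm (χ a) ^ m = 1 := by
        rw [← map_pow, ← MulChar.pow_apply' χ hm0, hχm, MulChar.one_apply ha, map_one]
      have h2 := Literature.NumberTheory.GaloisRepresentations.PadicAlgCl.norm_eq_one_of_pow_eq_one
        hm0 h1
      exact ⟨h2.le, fun _ ↦ h2⟩
    · rw [MulChar.map_nonunit χ ha, map_zero, norm_zero]
      exact ⟨zero_le_one, fun h ↦ (ha h).elim⟩
  have hnnat : ∀ q : ℕ, ‖ι.symm (q : ℂ)‖ ≤ 1 := fun q ↦ by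
    rw [map_natCast ι.symm q]; exact norm_natCast_le_one' q
  have hnM : ‖ι.symm (M : ℂ)‖ = 1 := by
    rw [map_natCast ι.symm M]
    exact Literature.NumberTheory.GaloisRepresentations.PadicAlgCl.norm_natCast_of_not_dvd hpM
  have hnterm : ∀ q : ℕ, ‖ι.symm (χ q * (q : ℂ) ^ (k - 1))‖ ≤ 1 := fun q ↦ by
    rw [map_mul, map_pow, norm_mul, norm_pow]
    exact mul_le_one₀ (hnχ (q : ZMod N)).1 (pow_nonneg (norm_nonneg _) _)
      (pow_le_one₀ (norm_nonneg _) (hnnat q))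
  have hnα : ‖ι.symm α‖ = 1 := by
    rw [hα, map_mul, map_pow, norm_mul, norm_pow, hnM, one_pow, mul_one]
    exact (hnχ (M : ZMod N)).2 ((ZMod.isUnit_prime_iff_not_dvd hM).2 hMN)
  have hnlam : ∀ q : ℕ, ‖ι.symm (lam q)‖ ≤ 1 := fun q ↦ by
    rw [hlam]
    simp only [map_add, map_one]
    exact (PadicAlgCl.isNonarchimedean p _ _).trans (max_le (by rw [norm_one]) (hnterm q))
  have hnpterm : ‖ι.symm (χ p * (p : ℂ) ^ (k - 1))‖ < 1 := by
    have hιp : ι.symm (p : ℂ) = (p : PadicAlgCl p) := map_natCast ι.symm p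
    rw [map_mul, map_pow, norm_mul, norm_pow, hιp]
    have h1 : ‖(p : PadicAlgCl p)‖ ^ (k - 1) < 1 :=
      pow_lt_one₀ (norm_nonneg _) norm_natCast_prime_lt_one' (by omega)
    exact mul_lt_one_of_nonneg_of_lt_one_right (hnχ (p : ZMod N)).1
      (pow_nonneg (norm_nonneg _) _) h1
  -- ### `(B)` `G` is an eigenvector modulo `𝔪`; `a_1(G)` is a unit
  have hGF' : ∀ n, ‖ι.symm (cuspCoeff G n) - ι.symm (b n)‖ < 1 := fun n ↦ by
    rw [← map_sub]; exact hGF n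
  have hunit : ‖ι.symm (cuspCoeff G 1)‖ = 1 := by
    refine norm_eq_one_of_norm_sub_lt_one (y := 1) norm_one ?_
    have h := hGF' 1
    rwa [hb1, map_one] at h
  -- `T_q`, `q ∤ NM`
  have hcongT : ∀ (q : ℕ) (hq : q.Prime), ¬ q ∣ N * M → ∀ n,
      ‖ι.symm (cuspCoeff ((haveI : NeZero q := ⟨hq.ne_zero⟩; heckeT (Gamma1 (N * M)) k q) G) n) -
        ι.symm (lam q) * ι.symm (cuspCoeff G n)‖ < 1 := by
    intro q hq hqL n
    haveI : NeZero q := ⟨hq.ne_zero⟩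
    have hcopZ : IsCoprime (q : ℤ) ((N * M : ℕ) : ℤ) :=
      Nat.isCoprime_iff_coprime.2 ((Nat.Prime.coprime_iff_not_dvd hq).2 hqL)
    have hχ'q : χ' (q : ZMod (N * M)) = χ (q : ZMod N) := by
      have h := DirichletCharacter.changeLevel_eq_cast_of_dvd' χ (dvd_mul_right N M) hcopZ
      simpa only [Int.cast_natCast] using h
    have hzpow : ((q : ℂ)) ^ ((k : ℤ) - 1) = (q : ℂ) ^ (k - 1) := by
      rw [show ((k : ℤ) - 1) = ((k - 1 : ℕ) : ℤ) by omega, zpow_natCast]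
    have hb' : ∀ n, n ≠ 0 → b (q * n) + χ' q * (q : ℂ) ^ ((k : ℤ) - 1) *
        (if q ∣ n then b (n / q) else 0) = lam q * b n := by
      intro n hn
      rw [hχ'q, hzpow]
      exact hbT q hq hqL n hn
    have hint : Valued.v (ι.symm (χ' q * (q : ℂ) ^ ((k : ℤ) - 1))) ≤ 1 := by
      rw [v_le_one_iff, hχ'q, hzpow]; exact hnterm q
    have hlam' : Valued.v (ι.symm (lam q)) ≤ 1 := by rw [v_le_one_iff]; exact hnlam q
    have hcong' : ∀ n, n ≠ 0 → Valued.v (ι.symm (cuspCoeff G n - b n)) < 1 := fun n _ ↦ by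
      rw [v_lt_one_iff]; exact hGF n
    have h := valuation_cuspCoeff_heckeT_sub_lt_one ι hGχ hq hqL b (lam q) hb' hint hlam' hcong' n
    rw [v_lt_one_iff, map_sub, map_mul] at h
    exact h
  -- `U_M`
  have hcongU : ∀ n, ‖ι.symm (cuspCoeff (heckeT (Gamma1 (N * M)) k M G) n) -
      ι.symm α * ι.symm (cuspCoeff G n)‖ < 1 := by
    intro n
    rw [cuspCoeff_heckeT_gamma1 G M hM n, if_pos hML, add_zero]
    have h1 := hGF' (M * n)
    have h2 : ‖ι.symm (b (M * n)) - ι.symm α * ι.symm (cuspCoeff G n)‖ < 1 := by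
      rw [hbU, map_mul, ← mul_sub, norm_mul, hnα, one_mul, ← norm_neg, neg_sub]
      exact hGF' n
    exact norm_sub_lt_one_trans' h1 h2
  -- ### `(C)` Deligne–Serre lifting inside `S_k(NM, χ)`
  let TL : ℕ → Module.End ℂ (CuspForm (Gamma1 (N * M)) k) := fun q ↦
    if hq : q = 0 then 0 else (haveI : NeZero q := ⟨hq⟩; heckeT (Gamma1 (N * M)) k q)
  have hTL : ∀ (q : ℕ) (hq : q ≠ 0),
      TL q = (haveI : NeZero q := ⟨hq⟩; heckeT (Gamma1 (N * M)) k q) := fun q hq ↦ dif_neg hq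
  have hTLM : TL M = heckeT (Gamma1 (N * M)) k M := hTL M hM.ne_zero
  let 𝒯 : Set (Module.End ℂ (CuspForm (Gamma1 (N * M)) k)) :=
    {T | ∃ q : ℕ, (q.Prime ∧ ¬ q ∣ N * M ∨ q = M) ∧ T = TL q}
  have h𝒯 : ∀ T ∈ 𝒯, ∃ q : ℕ, q.Prime ∧ T = TL q := by
    rintro T ⟨q, hq, rfl⟩
    rcases hq with hq | hq
    · exact ⟨q, hq.1, rfl⟩
    · exact ⟨q, hq ▸ hM, rfl⟩
  have hcomm : ∀ S ∈ 𝒯, ∀ T ∈ 𝒯, Commute S T := by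
    intro S hS T hT
    obtain ⟨q, hq, rfl⟩ := h𝒯 S hS
    obtain ⟨q', hq', rfl⟩ := h𝒯 T hT
    rw [hTL q hq.ne_zero, hTL q' hq'.ne_zero]
    haveI : NeZero q := ⟨hq.ne_zero⟩
    haveI : NeZero q' := ⟨hq'.ne_zero⟩
    exact heckeT_comm_holds (N * M) k q q'
  have hdiam : ∀ T ∈ 𝒯, ∀ d : (ZMod (N * M))ˣ,
      Commute T (diamondOp (N * M) k (d : ZMod (N * M))) := by
    intro T hT d
    obtain ⟨q, hq, rfl⟩ := h𝒯 T hT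
    rw [hTL q hq.ne_zero]
    haveI : NeZero q := ⟨hq.ne_zero⟩
    exact heckeT_diamondOp_comm_holds (N * M) k q (d : ZMod (N * M))
  have hΛ : ∀ T ∈ 𝒯, ∀ x ∈ integralLattice1 (N * M) k, T x ∈ integralLattice1 (N * M) k := by
    intro T hT x hx
    obtain ⟨q, hq, rfl⟩ := h𝒯 T hT
    rw [hTL q hq.ne_zero]
    haveI : NeZero q := ⟨hq.ne_zero⟩
    exact heckeT_mem_integralLattice1 hk1 hx q hq
  -- the targets: any admissible congruence class (they are unique modulo `𝔪`)
  let P : Module.End ℂ (CuspForm (Gamma1 (N * M)) k) → PadicAlgCl p → Prop := fun T c ↦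
    ‖c‖ ≤ 1 ∧ ∀ n, ‖ι.symm (cuspCoeff (T G) n) - c * ι.symm (cuspCoeff G n)‖ < 1
  let a : Module.End ℂ (CuspForm (Gamma1 (N * M)) k) → PadicAlgCl p := fun T ↦
    if h : ∃ c, P T c then h.choose else 0
  have haP : ∀ T c, P T c → P T (a T) := by
    intro T c hc
    have h : ∃ c, P T c := ⟨c, hc⟩
    simp only [a, dif_pos h]
    exact h.choose_spec
  have hPuniq : ∀ T c₁ c₂, P T c₁ → P T c₂ → ‖c₁ - c₂‖ < 1 := by
    intro T c₁ c₂ h₁ h₂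
    have h := norm_sub_lt_one_trans' (by rw [← norm_neg, neg_sub]; exact h₁.2 1) (h₂.2 1)
    rw [← sub_mul, norm_mul, hunit, mul_one] at h
    exact h
  have hPT : ∀ (q : ℕ) (hq : q.Prime), ¬ q ∣ N * M → P (TL q) (ι.symm (lam q)) := by
    intro q hq hqL
    refine ⟨hnlam q, fun n ↦ ?_⟩
    rw [hTL q hq.ne_zero]
    exact hcongT q hq hqL n
  have hPU : P (TL M) (ι.symm α) := ⟨hnα.le, fun n ↦ by rw [hTLM]; exact hcongU n⟩
  have ha : ∀ T ∈ 𝒯, ‖a T‖ ≤ 1 := by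
    intro T hT
    by_cases h : ∃ c, P T c
    · exact (haP T _ h.choose_spec).1
    · simp only [a, dif_neg h, norm_zero]; exact zero_le_one
  have hcongr : ∀ T ∈ 𝒯, ∀ n,
      ‖ι.symm (cuspCoeff (T G) n) - a T * ι.symm (cuspCoeff G n)‖ < 1 := by
    rintro T ⟨q, hq, rfl⟩ n
    rcases hq with hq | hq
    · exact (haP _ _ (hPT q hq.1 hq.2)).2 n
    · rw [hq]; exact (haP _ _ hPU).2 n
  have hχ'm : χ' ^ m = 1 := by rw [hχ', ← map_pow, hχm, map_one]
  obtain ⟨g₁, a', hg₁0, hg₁χ, hTg⟩ := DeligneSerreLift.exists_eigenform_of_congruence ι hk1 hm hχ'm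
    𝒯 hcomm hdiam hΛ a ha hGχ hGint hunit hcongr
  -- eigenvalues of `g₁`
  have hmemT : ∀ (q : ℕ), q.Prime → ¬ q ∣ N * M → TL q ∈ 𝒯 := fun q hq hqL ↦ ⟨q, Or.inl ⟨hq, hqL⟩, rfl⟩
  have hmemU : TL M ∈ 𝒯 := ⟨M, Or.inr rfl, rfl⟩
  have ha'T : ∀ (q : ℕ), q.Prime → ¬ q ∣ N * M → ‖a' (TL q) - ι.symm (lam q)‖ < 1 := by
    intro q hq hqL
    have h1 := (hTg _ (hmemT q hq hqL)).2.1
    have h2 := hPuniq _ _ _ (haP _ _ (hPT q hq hqL)) (hPT q hq hqL)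
    exact norm_sub_lt_one_trans' h1 h2
  have ha'U : ‖a' (TL M) - ι.symm α‖ < 1 :=
    norm_sub_lt_one_trans' (hTg _ hmemU).2.1 (hPuniq _ _ _ (haP _ _ hPU) hPU)
  have hna'U : ‖a' (TL M)‖ = 1 := norm_eq_one_of_norm_sub_lt_one hnα ha'U
  set u : ℂ := ι (a' (TL M)) with hu_def
  have hu : u ≠ 0 := by
    intro h0
    have h1 : a' (TL M) = 0 := by
      have := congrArg ι.symm h0
      rwa [hu_def, RingEquiv.symm_apply_apply, map_zero] at this
    rw [h1, norm_zero] at hna'U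
    exact zero_ne_one hna'U
  have hU : heckeT (Gamma1 (N * M)) k M g₁ = u • g₁ := by
    rw [← hTLM]; exact (hTg _ hmemU).2.2
  have hT : ∀ (q : ℕ) (hq : q.Prime), ¬ q ∣ N * M →
      (haveI : NeZero q := ⟨hq.ne_zero⟩; heckeT (Gamma1 (N * M)) k q) g₁ = ι (a' (TL q)) • g₁ := by
    intro q hq hqL
    rw [← hTL q hq.ne_zero]
    exact (hTg _ (hmemT q hq hqL)).2.2
  -- ### `(E)` bookkeeping of the congruences at good primes
  have hgood : ∀ (q : ℕ), q.Prime → ¬ q ∣ N * M → ∀ x : ℂ, x = ι (a' (TL q)) →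
      ‖ι.symm x - (1 + ι.symm (χ q * (q : ℂ) ^ (k - 1)))‖ < 1 := by
    rintro q hq hqL x rfl
    rw [RingEquiv.symm_apply_apply]
    have h := ha'T q hq hqL
    rwa [hlam, map_add, map_one] at h
  have hclose : ∀ x : ℂ, ‖ι.symm x - (1 + ι.symm (χ p * (p : ℂ) ^ (k - 1)))‖ < 1 →
      ‖ι.symm x - 1‖ < 1 := by
    intro x hx
    refine norm_sub_lt_one_trans' hx ?_
    rwa [add_sub_cancel_left]
  -- ### `(D)` the newform attached to `g₁`
  rcases exists_isNewform1_or_of_eigenvector_mul_prime hM hMN hχ hg₁0 hg₁χ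
      (a := fun q ↦ ι (a' (TL q))) hT hu hU with
    ⟨g, hgnew, hgq, hgχ⟩ | ⟨g, hgnew, hgq, hgM, hgχ⟩
  · -- level `NM`
    have hℓ : ∀ ℓ : ℕ, ℓ.Prime → ¬ ℓ ∣ N * M →
        ‖ι.symm (cuspCoeff g ℓ) - (1 + ι.symm (χ ℓ * (ℓ : ℂ) ^ (k - 1)))‖ < 1 ∧
          nebentypus g (ℓ : ZMod (N * M)) = χ (ℓ : ZMod N) := by
      intro ℓ hℓ hℓL
      refine ⟨hgood ℓ hℓ hℓL _ (hgq ℓ hℓ hℓL), ?_⟩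
      rw [hgχ]
      have hcopZ : IsCoprime (ℓ : ℤ) ((N * M : ℕ) : ℤ) :=
        Nat.isCoprime_iff_coprime.2 ((Nat.Prime.coprime_iff_not_dvd hℓ).2 hℓL)
      have h := DirichletCharacter.changeLevel_eq_cast_of_dvd' χ (dvd_mul_right N M) hcopZ
      simpa only [Int.cast_natCast] using h
    refine ⟨N * M, inferInstance, g, hgnew, hpL, Or.inr rfl, ?_, ?_, hℓ, ?_⟩
    · rw [hgχ, DirichletCharacter.conductor_changeLevel]; exact hχ
    · rw [hgχ]; exact hχ'm
    · exact hclose _ (hℓ p hp hpL).1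
  · -- level `N`
    have hℓ : ∀ ℓ : ℕ, ℓ.Prime → ¬ ℓ ∣ N →
        ‖ι.symm (cuspCoeff g ℓ) - (1 + ι.symm (χ ℓ * (ℓ : ℂ) ^ (k - 1)))‖ < 1 ∧
          nebentypus g (ℓ : ZMod N) = χ (ℓ : ZMod N) := by
      intro ℓ hℓ hℓN
      refine ⟨?_, by rw [hgχ]⟩
      by_cases hℓM : ℓ = M
      · subst hℓM
        rw [hgM]
        have hzpow : ((ℓ : ℂ)) ^ ((k : ℤ) - 1) = (ℓ : ℂ) ^ (k - 1) := by
          rw [show ((k : ℤ) - 1) = ((k - 1 : ℕ) : ℤ) by omega, zpow_natCast]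
        rw [hzpow, ← hα, map_add, map_mul, map_inv₀, hu_def, RingEquiv.symm_apply_apply]
        -- `‖(U + A/U) - (1 + A)‖ < 1` for `‖U - A‖ < 1`, `‖U‖ = ‖A‖ = 1`
        set U := a' (TL ℓ) with hUdef
        set A := ι.symm α with hAdef
        have hU0 : U ≠ 0 := fun h0 ↦ by rw [h0, norm_zero] at hna'U; exact zero_ne_one hna'U
        have h1 : ‖A * U⁻¹ - 1‖ < 1 := by
          have : A * U⁻¹ - 1 = (A - U) * U⁻¹ := by field_simp
          rw [this, norm_mul, norm_inv, hna'U, inv_one, mul_one, ← norm_neg, neg_sub]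
          exact ha'U
        have h2 : U + A * U⁻¹ - (1 + A) = (U - A) + (A * U⁻¹ - 1) := by ring
        rw [h2]
        exact (PadicAlgCl.isNonarchimedean p _ _).trans_lt (max_lt ha'U h1)
      · have hℓL : ¬ ℓ ∣ N * M := fun h ↦ (hℓ.dvd_mul.1 h).elim hℓN
          fun h' ↦ hℓM ((Nat.prime_dvd_prime_iff_eq hℓ hM).1 h')
        exact hgood ℓ hℓ hℓL _ (hgq ℓ hℓ hℓL)
    refine ⟨N, inferInstance, g, hgnew, hpN, Or.inl rfl, ?_, ?_, hℓ, ?_⟩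
    · rw [hgχ]; exact hχ
    · rw [hgχ]; exact hχm
    · exact hclose _ (hℓ p hp hpN).1

end Main

end Literature.NumberTheory.EllipticCurves.ModularForms
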